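import Summits.Ventures.PercRepro.RankLevelSetAbsorbStarLowPairs

/-! # RankLevelSetAbsorbStarLow — THE FIRST TWO STEPS OF (ABS-star) HOLD FOR EVERY FINITE MATROID:
`(#E − 2) · A^y_1 ≤ A^y_2` (`3 ≤ #E`) AND `(#E − 3) · A^y_2 ≤ 2 · A^y_3` (`5 ≤ #E`) (night-1 g34; dossier §46)

For a finite matroid `M` on `n = #E` elements and `y ∈ E`, the absorbing avoid-`y` profile is
`A^y_k = #lowAbsorbAt M y k = #{Z ∈ D_k : y ∉ Z, insert y Z dependent}` (g28/g32). g33's (ABS-star) is the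
star-normalized step `(n − 1 − k) · A^y_k ≤ k · A^y_{k+1}` for `2k + 1 ≤ n` (`BiIndepAbsorbStar`, a `Prop` clean on
every matroid with ≤ 9 elements). THIS MODULE PROVES THE STEPS `k = 1` AND `k = 2` UNCONDITIONALLY, by a fibre count
(`Finset.card_le_mul_card_image_of_maps_to`): the `(n − 1 − k) · A^y_k` pairs `(Z, e)`, `Z ∈ A^y_k`,
`e ∈ E ∖ (Z ∪ {y})` (`RankLevelSetAbsorbStarLowPairs`) go to `Z ∪ {e} ∈ A^y_{k+1}` when `e ∉ cl Z` (a REGULAR pair)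
and to `Z ∪ {e*}` for a fixed `e* ∈ E ∖ cl Z` when `e ∈ cl Z` (an EXCESS pair; `e` is then the unique element of
`cl Z ∖ (Z ∪ {y})`, `excess_unique_two`; at level `1` there is no excess, `eq_of_mem_closure_of_mem_lowAbsorbAt_one`).
The fibre over `W ∈ A^y_{k+1}` consists of the regular pairs `(W ∖ {e}, e)` with `W ∖ {e} ∈ A^y_k` — the REMOVABLE
elements of `W`, at most `k` of them (`card_removable_one_le_one`, `card_removable_le_two`, from
`not_all_pairs_absorb`) — and, at level `2`, at most one excess pair, whose presence forces the removable set down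
to `{e*}` (`removable_subset_of_excess`, from `not_mem_lowAbsorbAt_of_excess`). So every fibre has at most `k`
elements (`card_fiber_le_one`, `card_fiber_le_two`) and `(n − 1 − k) · A^y_k ≤ k · A^y_{k+1}`:
**`absorbStar_step_one`**, **`absorbStar_step_two`**, packaged as **`absorbStar_of_le_two`** (the shape of
`BiIndepAbsorbStar` at every `k ≤ 2`). CENSUS (night-1 g34, own exact code, dossier §46): the same local charging
`Σ_{Z ⊂ W} ex(Z)/(n − #cl Z) ≤ (|C_y(W)| − 2) + d(W)` holds at every step `2k + 2 ≤ n` of every matroid with ≤ 9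
elements whenever `y` is in no parallel pair, and fails at the middle step `2k + 1 = n` already for simple matroids
on 9 elements, where the Katona shadow form of (ABS-star) is false. Nothing here asserts (ABS-star); every
declaration has a docstring; imports: the cell's own modules and Mathlib only. Axioms: standard. -/
namespace PercRepro

open Set Matroid

variable {α : Type} [DecidableEq α] (M : Matroid α) [M.Finite]

/-! ## The map `(Z, e) ↦ Z ∪ {e}` (regular) / `Z ∪ {e*}` (excess) and its fibres -/

open Classical in
/-- **The map on pairs**: `(Z, e) ↦ insert e Z` when `e ∉ cl Z` (a REGULAR pair), and `(Z, e) ↦ insert e* Z` for a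
chosen `e* ∈ E ∖ cl Z` when `e ∈ cl Z` (an EXCESS pair; when no such `e*` exists the pair is sent to `insert e Z`
as well — this never happens at level `2` when `#E ≥ 5`, `exists_notMem_closure_two`). -/
noncomputable def absorbMap (p : Σ _ : Finset α, α) : Finset α :=
  if h : p.2 ∈ M.closure (↑p.1 : Set α) ∧ ∃ e ∈ M.E, e ∉ M.closure (↑p.1 : Set α) then
    insert (Classical.choose h.2) p.1 else insert p.2 p.1

omit [M.Finite] in
/-- A regular pair is sent to `insert e Z`. -/
lemma absorbMap_of_notMem_closure {p : Σ _ : Finset α, α} (h : p.2 ∉ M.closure (↑p.1 : Set α)) :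
    absorbMap M p = insert p.2 p.1 := by
  simp [absorbMap, h]

omit [M.Finite] in
/-- An excess pair is sent to `insert e* Z` for some `e* ∈ E ∖ cl Z`. -/
lemma absorbMap_of_mem_closure {p : Σ _ : Finset α, α} (h1 : p.2 ∈ M.closure (↑p.1 : Set α))
    (h2 : ∃ e ∈ M.E, e ∉ M.closure (↑p.1 : Set α)) :
    ∃ e, e ∈ M.E ∧ e ∉ M.closure (↑p.1 : Set α) ∧ absorbMap M p = insert e p.1 := by
  refine ⟨Classical.choose h2, (Classical.choose_spec h2).1, (Classical.choose_spec h2).2, ?_⟩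
  simp [absorbMap, h1, h2]

/-- **Adding an element outside the closure keeps a member a member, one level up**: for `Z ∈ absorbFinset M y k`
(`y ∈ E`) and `e ∈ E ∖ cl Z`, `insert e Z ∈ absorbFinset M y (k + 1)`. -/
lemma insert_mem_absorbFinset {y : α} (hy : y ∈ M.E) {k : ℕ} {Z : Finset α} (hZ : Z ∈ absorbFinset M y k)
    {e : α} (heE : e ∈ M.E) (hecl : e ∉ M.closure (↑Z : Set α)) : insert e Z ∈ absorbFinset M y (k + 1) := by
  rw [mem_absorbFinset] at hZ ⊢
  have hycl : y ∈ M.closure (↑Z : Set α) := mem_closure_of_mem_lowAbsorbAt M hy hZ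
  obtain ⟨⟨hZE, hZk, hZind, hcind⟩, hyZ, hdep⟩ := hZ
  have heZ : e ∉ (↑Z : Set α) := fun h => hecl (M.subset_closure _ hZE h)
  have hey : e ≠ y := fun h => hecl (h ▸ hycl)
  rw [Finset.coe_insert]
  refine ⟨⟨Set.insert_subset heE hZE, ?_, (hZind.insert_indep_iff_of_notMem heZ).mpr ⟨heE, hecl⟩,
    hcind.subset (Set.sdiff_subset_sdiff_right (Set.subset_insert _ _))⟩, ?_, ?_⟩
  · rw [Set.ncard_insert_of_notMem heZ (M.ground_finite.subset hZE), hZk]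
  · simp only [Set.mem_insert_iff, not_or]
    exact ⟨fun h => hey h.symm, hyZ⟩
  · intro hind
    exact hdep (hind.subset (Set.insert_subset_insert (Set.subset_insert _ _)))

/-- **The map sends the pairs of level `2` into the members of level `3`** (`y ∈ E`, `#E ≥ 5`). -/
lemma absorbMap_mem {y : α} (hy : y ∈ M.E) (hn : 5 ≤ M.E.ncard) {p : Σ _ : Finset α, α}
    (hp : p ∈ absorbPairs M y 2) : absorbMap M p ∈ absorbFinset M y 3 := by
  rw [mem_absorbPairs] at hp
  obtain ⟨hZ, heE, -, -⟩ := hp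
  by_cases hcl : p.2 ∈ M.closure (↑p.1 : Set α)
  · obtain ⟨e, heE', hecl, heq⟩ :=
      absorbMap_of_mem_closure M hcl (exists_notMem_closure_two M hn ((mem_absorbFinset M).mp hZ))
    rw [heq]
    exact insert_mem_absorbFinset M hy hZ heE' hecl
  · rw [absorbMap_of_notMem_closure M hcl]
    exact insert_mem_absorbFinset M hy hZ heE hcl

/-- **The removable elements of `W` at level `k`**: `e ∈ W` with `W ∖ {e}` a member at level `k`. -/
noncomputable def removable (y : α) (k : ℕ) (W : Finset α) : Finset α :=
  W.filter (fun e => W.erase e ∈ absorbFinset M y k)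

/-- Membership in `removable`. -/
lemma mem_removable {y : α} {k : ℕ} {W : Finset α} {e : α} :
    e ∈ removable M y k W ↔ e ∈ W ∧ W.erase e ∈ absorbFinset M y k := by
  simp [removable]

/-- **A member at level `3` has at most two removable elements** (`not_all_pairs_absorb`). -/
lemma card_removable_le_two {y : α} (hy : y ∈ M.E) {W : Finset α} (hW : W ∈ absorbFinset M y 3) :
    (removable M y 2 W).card ≤ 2 := by
  have hW' := (mem_absorbFinset M).mp hW
  have hcard : W.card = 3 := by
    have := hW'.1.2.1
    rwa [Set.ncard_coe_finset] at this
  obtain ⟨a, b, c, hab, hac, hbc, rfl⟩ := Finset.card_eq_three.mp hcard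
  by_contra hlt
  push Not at hlt
  have hsub : removable M y 2 {a, b, c} ⊆ {a, b, c} := Finset.filter_subset _ _
  have heq : removable M y 2 {a, b, c} = {a, b, c} :=
    Finset.eq_of_subset_of_card_le hsub (by rw [hcard]; omega)
  have ha : a ∈ removable M y 2 {a, b, c} := by rw [heq]; simp
  have hb : b ∈ removable M y 2 {a, b, c} := by rw [heq]; simp
  have hc : c ∈ removable M y 2 {a, b, c} := by rw [heq]; simp
  rw [mem_removable] at ha hb hc
  have hea : ({a, b, c} : Finset α).erase a = {b, c} := Finset.erase_insert (by simp [hab, hac])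
  have heb : ({a, b, c} : Finset α).erase b = {a, c} := by
    rw [Finset.erase_insert_of_ne hab, Finset.erase_insert (by simp [hbc])]
  have hec : ({a, b, c} : Finset α).erase c = {a, b} := by
    rw [Finset.erase_insert_of_ne hac, Finset.erase_insert_of_ne hbc, Finset.erase_singleton,
      Finset.insert_empty]
  rw [hea, mem_absorbFinset] at ha
  rw [heb, mem_absorbFinset] at hb
  rw [hec, mem_absorbFinset] at hc
  simp only [Finset.coe_insert, Finset.coe_singleton] at ha hb hc hW'
  exact not_all_pairs_absorb M hy hab hac hbc hW' ha.2 hb.2 hc.2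

/-- **An excess pair forces the removable set of its image down to `{e*}`** (`not_mem_lowAbsorbAt_of_excess`):
if `Z ∈ absorbFinset M y 2` has an excess element `f` (`f ∈ cl Z`, `f ∉ Z`, `f ≠ y`) and `e* ∈ E ∖ cl Z`, then
`removable M y (insert e* Z) ⊆ {e*}`. -/
lemma removable_subset_of_excess {y : α} (hy : y ∈ M.E) {Z : Finset α} (hZ : Z ∈ absorbFinset M y 2) {f : α}
    (hf : f ∈ M.closure (↑Z : Set α)) (hfZ : f ∉ Z) (hfy : f ≠ y) {e : α} (heE : e ∈ M.E)
    (hecl : e ∉ M.closure (↑Z : Set α)) : removable M y 2 (insert e Z) ⊆ {e} := by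
  have hZ' := (mem_absorbFinset M).mp hZ
  have hcard : Z.card = 2 := by
    have := hZ'.1.2.1
    rwa [Set.ncard_coe_finset] at this
  obtain ⟨b, c, hbc, rfl⟩ := Finset.card_eq_two.mp hcard
  have heZ : e ∉ ({b, c} : Finset α) := fun h => hecl (M.subset_closure _ hZ'.1.1 (by simpa using h))
  have heb : e ≠ b := fun h => heZ (by simp [h])
  have hec : e ≠ c := fun h => heZ (by simp [h])
  simp only [Finset.coe_insert, Finset.coe_singleton] at hZ' hf hecl
  intro x hx
  rw [mem_removable] at hx
  obtain ⟨hxW, hxe⟩ := hx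
  rw [Finset.mem_singleton]
  by_contra hxe'
  simp only [Finset.mem_insert, Finset.mem_singleton] at hxW
  rcases hxW with rfl | rfl | rfl
  · exact hxe' rfl
  · -- `x = b`: `(insert e {b, c}).erase b = {e, c}`
    rw [Finset.erase_insert_of_ne heb, Finset.erase_insert (by simp [hbc]), mem_absorbFinset] at hxe
    simp only [Finset.coe_insert, Finset.coe_singleton] at hxe
    have hfZ' : f ∉ ({x, c} : Set α) := by simpa using hfZ
    exact not_mem_lowAbsorbAt_of_excess M hy hbc hZ' hf hfZ' hfy heE hecl hxe
  · -- `x = c`: `(insert e {b, c}).erase c = {e, b}`; apply the lemma with `b` and `c` exchanged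
    rw [Finset.erase_insert_of_ne hec, Finset.erase_insert_of_ne hbc, Finset.erase_singleton,
      Finset.insert_empty, mem_absorbFinset] at hxe
    simp only [Finset.coe_insert, Finset.coe_singleton] at hxe
    have hpair : ({b, x} : Set α) = {x, b} := Set.pair_comm b x
    rw [hpair] at hZ' hf hecl
    have hfZ' : f ∉ ({x, b} : Set α) := by
      rw [← hpair]; simpa using hfZ
    exact not_mem_lowAbsorbAt_of_excess M hy (Ne.symm hbc) hZ' hf hfZ' hfy heE hecl hxe

/-- **Every fibre of the map over a member at level `3` has at most two pairs**: the regular pairs in the fibre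
inject into the removable elements (at most two), and an excess pair in the fibre is unique and forces the removable
set down to one element. -/
lemma card_fiber_le_two {y : α} (hy : y ∈ M.E) (hn : 5 ≤ M.E.ncard) {W : Finset α}
    (hW : W ∈ absorbFinset M y 3) :
    ((absorbPairs M y 2).filter (fun p => absorbMap M p = W)).card ≤ 2 := by
  classical
  set F := (absorbPairs M y 2).filter (fun p => absorbMap M p = W) with hF
  have hsplit := Finset.card_filter_add_card_filter_not (s := F)
    (fun p : Σ _ : Finset α, α => p.2 ∉ M.closure (↑p.1 : Set α))
  -- the regular part injects into the removable elements
  have hreg : (F.filter (fun p : Σ _ : Finset α, α => p.2 ∉ M.closure (↑p.1 : Set α))).card ≤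
      (removable M y 2 W).card := by
    refine Finset.card_le_card_of_injOn (fun p => p.2) ?_ ?_
    · intro p hp
      simp only [Finset.coe_filter, Set.mem_setOf_eq, hF, Finset.mem_filter] at hp
      obtain ⟨⟨hp1, hp2⟩, hp3⟩ := hp
      rw [absorbMap_of_notMem_closure M hp3] at hp2
      rw [mem_absorbPairs] at hp1
      rw [Finset.mem_coe, mem_removable, ← hp2, Finset.erase_insert hp1.2.2.2]
      exact ⟨Finset.mem_insert_self _ _, hp1.1⟩
    · intro p hp q hq hpq
      simp only [Finset.coe_filter, Set.mem_setOf_eq, hF, Finset.mem_filter] at hp hq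
      obtain ⟨⟨hp1, hp2⟩, hp3⟩ := hp
      obtain ⟨⟨hq1, hq2⟩, hq3⟩ := hq
      rw [absorbMap_of_notMem_closure M hp3] at hp2
      rw [absorbMap_of_notMem_closure M hq3] at hq2
      rw [mem_absorbPairs] at hp1 hq1
      have hpq' : p.2 = q.2 := hpq
      have h1 : p.1 = q.1 := by
        rw [← Finset.erase_insert hp1.2.2.2, ← Finset.erase_insert hq1.2.2.2, hp2, hq2, hpq']
      exact Sigma.ext h1 (heq_of_eq hpq')
  -- an excess pair in the fibre
  by_cases hex : (F.filter (fun p : Σ _ : Finset α, α => ¬ p.2 ∉ M.closure (↑p.1 : Set α))).Nonempty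
  · obtain ⟨p, hp⟩ := hex
    simp only [hF, Finset.mem_filter, not_not] at hp
    obtain ⟨⟨hp1, hp2⟩, hp3⟩ := hp
    rw [mem_absorbPairs] at hp1
    obtain ⟨e, heE, hecl, heq⟩ :=
      absorbMap_of_mem_closure M hp3 (exists_notMem_closure_two M hn ((mem_absorbFinset M).mp hp1.1))
    have hsub : removable M y 2 W ⊆ {e} := by
      rw [← hp2, heq]
      exact removable_subset_of_excess M hy hp1.1 hp3 hp1.2.2.2 hp1.2.2.1 heE hecl
    have hR1 : (removable M y 2 W).card ≤ 1 := by
      have := Finset.card_le_card hsub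
      rwa [Finset.card_singleton] at this
    -- any two excess pairs in the fibre coincide
    have hexc : (F.filter (fun p : Σ _ : Finset α, α => ¬ p.2 ∉ M.closure (↑p.1 : Set α))).card ≤ 1 := by
      rw [Finset.card_le_one]
      intro q hq r hr
      simp only [hF, Finset.mem_filter, not_not] at hq hr
      obtain ⟨⟨hq1, hq2⟩, hq3⟩ := hq
      obtain ⟨⟨hr1, hr2⟩, hr3⟩ := hr
      rw [mem_absorbPairs] at hq1 hr1
      obtain ⟨eq, heqE, heqcl, heqq⟩ :=
        absorbMap_of_mem_closure M hq3 (exists_notMem_closure_two M hn ((mem_absorbFinset M).mp hq1.1))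
      obtain ⟨er, herE, hercl, herr⟩ :=
        absorbMap_of_mem_closure M hr3 (exists_notMem_closure_two M hn ((mem_absorbFinset M).mp hr1.1))
      -- both `eq` and `er` are removable elements of `W`, hence equal to `e`
      have heqZ : eq ∉ q.1 := fun h => heqcl (M.subset_closure _ ((mem_absorbFinset M).mp hq1.1).1.1 (by simpa using h))
      have herZ : er ∉ r.1 := fun h => hercl (M.subset_closure _ ((mem_absorbFinset M).mp hr1.1).1.1 (by simpa using h))
      have hq' : q.1 = W.erase eq := by rw [← hq2, heqq, Finset.erase_insert heqZ]
      have hr' : r.1 = W.erase er := by rw [← hr2, herr, Finset.erase_insert herZ]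
      have heqR : eq ∈ removable M y 2 W := by
        rw [mem_removable, ← hq']
        exact ⟨by rw [← hq2, heqq]; exact Finset.mem_insert_self _ _, hq1.1⟩
      have herR : er ∈ removable M y 2 W := by
        rw [mem_removable, ← hr']
        exact ⟨by rw [← hr2, herr]; exact Finset.mem_insert_self _ _, hr1.1⟩
      have heq_e : eq = e := Finset.mem_singleton.mp (hsub heqR)
      have her_e : er = e := Finset.mem_singleton.mp (hsub herR)
      have h1 : q.1 = r.1 := by rw [hq', hr', heq_e, her_e]
      -- the excess elements coincide by `excess_unique_two`
      have h2 : q.2 = r.2 := by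
        have hq1' := (mem_absorbFinset M).mp hq1.1
        have hr3' : r.2 ∈ M.closure (↑q.1 : Set α) := by rw [h1]; exact hr3
        have hr4 : r.2 ∉ q.1 := by rw [h1]; exact hr1.2.2.2
        exact excess_unique_two M hy hq1' hq3 (by simpa using hq1.2.2.2) hq1.2.2.1 hr3'
          (by simpa using hr4) hr1.2.2.1
      exact Sigma.ext h1 (heq_of_eq h2)
    omega
  · rw [Finset.not_nonempty_iff_eq_empty] at hex
    rw [hex, Finset.card_empty] at hsplit
    have := card_removable_le_two M hy hW
    omega

/-! ## Level `1`: no excess, at most one removable element -/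

omit [DecidableEq α] in
/-- **A member at level `1` has no excess**: `cl Z ⊆ Z ∪ {y}` (an element `f ∈ cl Z ∖ (Z ∪ {y})` would make
`{f, y} ⊆ E ∖ Z` an independent `2`-set inside the rank-`1` flat `cl Z`). -/
lemma eq_of_mem_closure_of_mem_lowAbsorbAt_one {y : α} (hy : y ∈ M.E) {Z : Set α}
    (hZ : Z ∈ lowAbsorbAt M y 1) {f : α} (hf : f ∈ M.closure Z) (hfZ : f ∉ Z) : f = y := by
  by_contra hfy
  have hycl : y ∈ M.closure Z := mem_closure_of_mem_lowAbsorbAt M hy hZ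
  obtain ⟨⟨hZE, hZk, hZind, hcind⟩, hyZ, -⟩ := hZ
  have hfE : f ∈ M.E := M.closure_subset_ground Z hf
  have hind : M.Indep {f, y} := hcind.subset (by
    intro x hx
    simp only [Set.mem_insert_iff, Set.mem_singleton_iff] at hx
    rcases hx with rfl | rfl
    · exact ⟨hfE, hfZ⟩
    · exact ⟨hy, hyZ⟩)
  have hsubcl : ({f, y} : Set α) ⊆ M.closure Z := by
    intro x hx
    simp only [Set.mem_insert_iff, Set.mem_singleton_iff] at hx
    rcases hx with rfl | rfl
    · exact hf
    · exact hycl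
  have h1 := hind.encard_le_eRk_of_subset hsubcl
  rw [M.eRk_closure_eq, hZind.eRk_eq_encard, ← Set.Finite.cast_ncard_eq (M.ground_finite.subset hZE), hZk,
    Set.encard_pair hfy] at h1
  norm_num at h1

/-- **The pairs of level `1` are all regular**, so the map sends them to `insert e Z ∈ absorbFinset M y 2`. -/
lemma absorbMap_mem_one {y : α} (hy : y ∈ M.E) {p : Σ _ : Finset α, α} (hp : p ∈ absorbPairs M y 1) :
    absorbMap M p = insert p.2 p.1 ∧ absorbMap M p ∈ absorbFinset M y 2 := by
  rw [mem_absorbPairs] at hp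
  obtain ⟨hZ, heE, hey, heZ⟩ := hp
  have hcl : p.2 ∉ M.closure (↑p.1 : Set α) := fun h =>
    hey (eq_of_mem_closure_of_mem_lowAbsorbAt_one M hy ((mem_absorbFinset M).mp hZ) h (by simpa using heZ))
  exact ⟨absorbMap_of_notMem_closure M hcl, by
    rw [absorbMap_of_notMem_closure M hcl]
    exact insert_mem_absorbFinset M hy hZ heE hcl⟩

/-- **A member at level `2` has at most one removable element at level `1`**: if `W = {a, b}` and both `{a}` and
`{b}` absorb `y`, then `a, b ∈ cl {y}` against the independence of `W`. -/
lemma card_removable_one_le_one {y : α} (hy : y ∈ M.E) {W : Finset α} (hW : W ∈ absorbFinset M y 2) :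
    (removable M y 1 W).card ≤ 1 := by
  have hW' := (mem_absorbFinset M).mp hW
  have hcard : W.card = 2 := by
    have := hW'.1.2.1
    rwa [Set.ncard_coe_finset] at this
  obtain ⟨a, b, hab, rfl⟩ := Finset.card_eq_two.mp hcard
  by_contra hlt
  push Not at hlt
  have hsub : removable M y 1 {a, b} ⊆ {a, b} := Finset.filter_subset _ _
  have heq : removable M y 1 {a, b} = {a, b} :=
    Finset.eq_of_subset_of_card_le hsub (by rw [hcard]; omega)
  have ha : a ∈ removable M y 1 {a, b} := by rw [heq]; simp
  have hb : b ∈ removable M y 1 {a, b} := by rw [heq]; simp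
  rw [mem_removable] at ha hb
  have hea : ({a, b} : Finset α).erase a = {b} := Finset.erase_insert (by simp [hab])
  have heb : ({a, b} : Finset α).erase b = {a} := by
    rw [Finset.erase_insert_of_ne hab, Finset.erase_singleton, Finset.insert_empty]
  rw [hea, mem_absorbFinset] at ha
  rw [heb, mem_absorbFinset] at hb
  simp only [Finset.coe_insert, Finset.coe_singleton] at ha hb hW'
  have hy1 : M.Indep {y} := indep_singleton_of_mem_lowAbsorbAt M hy hW'
  have hay : a ∈ M.closure {y} :=
    mem_closure_singleton_symm M hy1 (mem_closure_of_mem_lowAbsorbAt M hy hb.2)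
  have hby : b ∈ M.closure {y} :=
    mem_closure_singleton_symm M hy1 (mem_closure_of_mem_lowAbsorbAt M hy ha.2)
  have hsubcl : ({a, b} : Set α) ⊆ M.closure {y} := by
    intro x hx
    simp only [Set.mem_insert_iff, Set.mem_singleton_iff] at hx
    rcases hx with rfl | rfl
    · exact hay
    · exact hby
  have h1 := hW'.1.2.2.1.encard_le_eRk_of_subset hsubcl
  rw [M.eRk_closure_eq, Set.encard_pair hab] at h1
  have h2 := h1.trans (M.eRk_le_encard _)
  rw [Set.encard_singleton] at h2
  norm_num at h2

/-- **Every fibre of the map over a member at level `2` has at most one pair of level `1`.** -/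
lemma card_fiber_le_one {y : α} (hy : y ∈ M.E) {W : Finset α} (hW : W ∈ absorbFinset M y 2) :
    ((absorbPairs M y 1).filter (fun p => absorbMap M p = W)).card ≤ 1 := by
  refine (Finset.card_le_card_of_injOn (t := removable M y 1 W) (fun p => p.2) ?_ ?_).trans
    (card_removable_one_le_one M hy hW)
  · intro p hp
    simp only [Finset.coe_filter, Set.mem_setOf_eq] at hp
    obtain ⟨hp1, hp2⟩ := hp
    obtain ⟨heq, -⟩ := absorbMap_mem_one M hy hp1
    rw [heq] at hp2
    rw [mem_absorbPairs] at hp1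
    rw [Finset.mem_coe, mem_removable, ← hp2, Finset.erase_insert hp1.2.2.2]
    exact ⟨Finset.mem_insert_self _ _, hp1.1⟩
  · intro p hp q hq hpq
    simp only [Finset.coe_filter, Set.mem_setOf_eq] at hp hq
    obtain ⟨hp1, hp2⟩ := hp
    obtain ⟨hq1, hq2⟩ := hq
    obtain ⟨heqp, -⟩ := absorbMap_mem_one M hy hp1
    obtain ⟨heqq, -⟩ := absorbMap_mem_one M hy hq1
    rw [heqp] at hp2
    rw [heqq] at hq2
    rw [mem_absorbPairs] at hp1 hq1
    have hpq' : p.2 = q.2 := hpq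
    have h1 : p.1 = q.1 := by
      rw [← Finset.erase_insert hp1.2.2.2, ← Finset.erase_insert hq1.2.2.2, hp2, hq2, hpq']
    exact Sigma.ext h1 (heq_of_eq hpq')

/-! ## The theorems -/
/-- **THE STEP `k = 2` OF (ABS-star) FOR EVERY FINITE MATROID**: for `y ∈ E` and `5 ≤ #E`,
`(#E − 3) · A^y_2 ≤ 2 · A^y_3`. -/
theorem absorbStar_step_two {y : α} (hy : y ∈ M.E) (hn : 5 ≤ M.E.ncard) :
    (M.E.ncard - 3) * lowAbsorbCount M y 2 ≤ 2 * lowAbsorbCount M y 3 := by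
  have h1 : (M.E.ncard - 2 - 1) * lowAbsorbCount M y 2 = (absorbPairs M y 2).card :=
    (card_absorbPairs M hy 2).symm
  have h2 : (absorbPairs M y 2).card ≤ 2 * (absorbFinset M y 3).card :=
    Finset.card_le_mul_card_image_of_maps_to (fun p hp => absorbMap_mem M hy hn hp) 2
      (fun W hW => card_fiber_le_two M hy hn hW)
  rw [lowAbsorbCount_eq_card M y 3, show M.E.ncard - 3 = M.E.ncard - 2 - 1 by omega, h1]
  exact h2

/-- **THE STEP `k = 1` OF (ABS-star) FOR EVERY FINITE MATROID**: for `y ∈ E` and `3 ≤ #E`,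
`(#E − 2) · A^y_1 ≤ A^y_2`. -/
theorem absorbStar_step_one {y : α} (hy : y ∈ M.E) :
    (M.E.ncard - 2) * lowAbsorbCount M y 1 ≤ lowAbsorbCount M y 2 := by
  have h1 : (M.E.ncard - 1 - 1) * lowAbsorbCount M y 1 = (absorbPairs M y 1).card :=
    (card_absorbPairs M hy 1).symm
  have h2 : (absorbPairs M y 1).card ≤ 1 * (absorbFinset M y 2).card :=
    Finset.card_le_mul_card_image_of_maps_to (fun p hp => (absorbMap_mem_one M hy hp).2) 1
      (fun W hW => card_fiber_le_one M hy hW)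
  rw [lowAbsorbCount_eq_card M y 2, show M.E.ncard - 2 = M.E.ncard - 1 - 1 by omega, h1]
  exact h2.trans (by omega)

omit [DecidableEq α] in
/-- **(ABS-star) HOLDS AT EVERY STEP `k ≤ 2` OF EVERY FINITE MATROID**: for `y ∈ E` and `k ≤ 2` with
`2k + 1 ≤ #E`, `(#E − 1 − k) · A^y_k ≤ k · A^y_{k+1}` — the shape of `BiIndepAbsorbStar` restricted to `k ≤ 2`. -/
theorem absorbStar_of_le_two {y : α} (hy : y ∈ M.E) {k : ℕ} (hk2 : k ≤ 2) (hk : 2 * k + 1 ≤ M.E.ncard) :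
    (M.E.ncard - 1 - k) * lowAbsorbCount M y k ≤ k * lowAbsorbCount M y (k + 1) := by
  classical
  rcases Nat.lt_or_ge k 1 with h0 | h1
  · have hk0 : k = 0 := by omega
    subst hk0
    rw [lowAbsorbCount_zero M hy]
    simp
  rcases Nat.lt_or_ge k 2 with h1' | h2
  · have hk1 : k = 1 := by omega
    subst hk1
    rw [show M.E.ncard - 1 - 1 = M.E.ncard - 2 by omega, one_mul]
    exact absorbStar_step_one M hy
  · have hk2' : k = 2 := by omega
    subst hk2'
    rw [show M.E.ncard - 1 - 2 = M.E.ncard - 3 by omega]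
    exact absorbStar_step_two M hy (by omega)
end PercRepro
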